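import Summits.ABC.IUTFork.Cor312ProvK
import Summits.ABC.IUTFork.Cor312ProvenancePlacesOver
import HarnessLib

/-!
# [IUTchI] Def. 3.1 (e) index bookkeeping AT THE `K`-LEVEL: the Dupuy–Hilado index set `𝕍(K)` of the `K`-level
# pilot datum RETRACTS onto `V̲ ⊆ V(K)` — natural projection `π : 𝕍(K) ↠ V̲`, inclusion `ι : V̲ ↪ 𝕍(K)`,
# `π ∘ ι = id`, `𝕍(K)^bad = π⁻¹(V̲^bad)`, `V̲^bad = ι⁻¹(𝕍(K)^bad) = V̲ ∩ 𝕍(K)^bad`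

S. Mochizuki, *Inter-universal Teichmüller theory I*, §3, Def. 3.1 (b) "`V(F)^bad := V^bad_mod ×_{V_mod} V(F)`", (e) "`V̲ ⊆ V(K)` is a
subset that induces a natural bijection `V̲ ⥲ V_mod`, i.e., a section of the natural surjection `V(K) ↠ V_mod` … `V̲^bad := V̲ ∩ V(K)^bad`"
(kurims final manuscript pp. 61–62), Ex. 3.2 (iv) p. 71 (local data at `v̲ ∈ V̲^bad` over `K_v̲`); [IUTchIV] Def. 1.9 (ii) p. 22 (places
of `L` over places of `F`); T. Dupuy, A. Hilado, *The statement of Mochizuki's Corollary 3.12*, §3.3 (`S` = bad places), §3.6 (`V(F)_p`).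

PROOF-ONLY record file (D-0012; no `def`, no `Prop` fact, no instance) of the abc-iut cell — R2 S-CHAIN TEAM seat abc-iut-s2-p11 (gen 2;
minted target «hplaces», second alternative «re-index over abc-iut-c312-5's `thetaIndexOfInitial`»; CLAIM «hplaces-K» on HOME/STATUS.md
2026-08-26T09:3xZ). TAKES NO SIDE on [IUTchIII] Cor. 3.12: elementary bookkeeping about the INDEX SETS of abc-iut-c312-5's
`Thm311.Real.thetaIndex Y` for Dupuy–Hilado pilot data `Y` OVER `K` (`V = 𝕍(K) = Thm311.Real.Place K`, `V^bad = S`), of its `M`-level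
skeleton `Thm311.Real.thetaIndexOfInitial D` (`V := ↥V̲`, `V^bad := V̲^bad`), and of abc-iut-L5-t2's REAL `InitialThetaData`
(`D.V = V̲ ⊆ Val K`, `D.Vbad = V̲^bad`).

CONTEXT. The branch-C certificate v5 (C-lead ruling C-R16 (b), repair R1 of FINDING C-cert-3-F1) reads the genuine real setting over the
`K`-LEVEL pilot datum `Cor312Prov.pilotDataOfK D K` of abc-iut-C-cert-3 (`Cor312ProvK.lean`, p434046: abc-iut-c312-8's `pilotDataOfF D`
base-changed along `F ⊆ K`; provenance structure `IsPilotDataOfK D K Y`: `S` = the primes of `K` over `𝕍(F)^bad`). The companion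
`Cor312ProvenancePlacesOver.lean` (p433104, this seat gen 0) recorded the index bookkeeping at the `F`-level: a SURJECTION `𝕍(F) ↠ V̲`
which is NOT injective as soon as a place of `F_mod` splits in `F` — no index embedding `V̲ ↪ 𝕍(F)` compatible with restriction exists
there in general. AT THE `K`-LEVEL the situation is print's own: `V̲` IS a subset of `V(K) = 𝕍(K)`. THIS FILE records, with no side
condition beyond the provenance link `IsPilotDataOfK D K Y`:

* §1 `exists_placeProjK` / `placeProjK_unique` — exactly one map `π : 𝕍(K) → V̲` COMPATIBLE WITH RESTRICTION TO `V_mod`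
  (`toVMod (π w) = toVMod w`), built from L5-t2's `underline`; `placeProjK_section` — **`π (ι v̲) = v̲`** for the inclusion
  `ι : V̲ → 𝕍(K)` reading a member of `V̲ ⊆ Val K` as a place of `K` (Def. 3.1 (e) "a section of the natural surjection"); hence
  `placeProjK_surjective` and **`placeInclK_injective`**; `placeProjK_eq_placeProj_below` — `π` factors through the `F`-level projection of
  p433104 along [IUTchIV] Def. 1.9 (ii)'s `Place.below F K : 𝕍(K) → 𝕍(F)` (tower `F_mod ⊆ F ⊆ K`);
* §2 `mem_Vbad_iff_placeProjK_mem` — `w ∈ (thetaIndex Y).Vbad ↔ π w ∈ V̲^bad` (`𝕍(K)^bad = S` IS `π⁻¹(V̲^bad)`: Def. 3.1 (b)'s fibre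
  product over `K`, read through `IsPilotDataOfK.mem_S_iff` and `(𝔓 ∩ 𝓞_F) ∩ 𝓞_{F_mod} = 𝔓 ∩ 𝓞_{F_mod}`); `placeProjK_image_Vbad`;
  **`mem_thetaIndexOfInitial_Vbad_iff_placeInclK_mem`** — `v̲ ∈ (thetaIndexOfInitial D).Vbad ↔ ι v̲ ∈ (thetaIndex Y).Vbad`
  ("`V̲^bad := V̲ ∩ V(K)^bad`" verbatim); `placeInclK_preimage_Vbad`;
* §3 fibres: `placeProjK_inr_eq_iff`, `not_injective_placeProjK_of_two_above` (π is a bijection only if no place of `F_mod` has two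
  places of `K` above it);
* §4 headlines: **`exists_placeIncl_injective_mem_Vbad_iff`** — `∃ ι : (thetaIndexOfInitial D).V → (thetaIndex Y).V, Injective ι ∧
  ∀ v, v ∈ (thetaIndexOfInitial D).Vbad ↔ ι v ∈ (thetaIndex Y).Vbad`: abc-iut-c312-5's `M`-level index skeleton RE-INDEXES INTO the
  `K`-level Dupuy–Hilado one respecting bad places (the honest, injective form at the `K`-level of the deleted v3/v4 READ binder
  `hplaces : ∃ e : (thetaIndex X).V ≃ D.V, …`); **`exists_placeProjK_surjective_section_mem_Vbad_iff`** — the surjection WITH its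
  section; and both INSTANTIATED at v5's own datum `pilotDataOfK D K` (`…_pilotDataOfK`, via `isPilotDataOfK_pilotDataOfK`) —
  the provenance sentence available to v5 for EVERY genuine datum («the DH index set `𝕍(K)` CONTAINS `V̲` as a retract, `𝕍(K)^bad`
  the preimage of `V̲^bad`, `V̲^bad = V̲ ∩ 𝕍(K)^bad`»). v5 carries no places binder; nothing is discharged or added here.

HONEST FRAMING: bookkeeping about OUR typed index sets, proved in the kernel (classical algebraic number theory: primes in a tower of
number fields); nothing here asserts or denies [IUTchIII] Cor. 3.12 or abc, or takes a side on any author (Mochizuki / Scholze–Stix /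
Joshi / Dupuy–Hilado); typed ≠ proved; instantiated ≠ endorsed. [claim: Mochizuki2012, status: disputed] for the quoted definitions.
[cite: Mochizuki2012, IUTchI Def. 3.1 (b)(e) pp. 61–62, Ex. 3.2 (iv) p. 71; IUTchIV Def. 1.9 (ii) p. 22] [cite: DupuyHilado2025, §3.3, §3.6]
-/

noncomputable section

open NumberField IsDedekindDomain Set

namespace Summit.ABC.IUTFork.Cor312Prov

open Literature.IUT.HodgeTheaters Literature.IUT.LogVolume Thm311 Thm311.Real

variable {F K Fbar : Type} [Field F] [NumberField F] [Field K] [NumberField K] [Algebra F K] [Field Fbar]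
  [Algebra F Fbar] [Algebra K Fbar] {E : WeierstrassCurve F} [E.IsElliptic] {l : ℕ} {Pb : BadPlacePredicates K}
  (D : InitialThetaData F K Fbar E l Pb) {Y : PilotData K}

/-! ## 1. The natural projection `𝕍(K) → V̲` and the inclusion `V̲ ↪ 𝕍(K)`: a retraction -/

/-- **Existence of the natural projection `π : 𝕍(K) → V̲`** COMPATIBLE WITH RESTRICTION TO `V_mod`: `π w` is the member of `V̲` over
the valuation `w|_{F_mod}` of `F_mod` (`toVMod (π w) = toVMod w`, the place `w` of `K` read as a valuation of `K`: archimedean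
`w = a ↦ Val.arc a`, finite `w = 𝔓 ↦ Val.non (FinitePlace.mk 𝔓)`) — L5-t2's `v ↦ v̲` (`InitialThetaData.underline`, the inverse of the
bijection `V̲ ⥲ V_mod` of [IUTchI] Def. 3.1 (e)) after the restriction `V(K) → V_mod` (`toVMod`). PROVED (classical bookkeeping).
[cite: Mochizuki2012, IUTchI Def. 3.1 (e) p. 62] [claim: Mochizuki2012, status: disputed] -/
theorem exists_placeProjK :
    ∃ π : Thm311.Real.Place K → D.V, ∀ w : Thm311.Real.Place K, toVMod F K E ((π w : D.V) : Val K) =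
      toVMod F K E (Sum.elim Val.arc (fun 𝔓 => Val.non (FinitePlace.mk 𝔓)) w) :=
  ⟨fun w => ⟨D.underline (toVMod F K E (Sum.elim Val.arc (fun 𝔓 => Val.non (FinitePlace.mk 𝔓)) w)), D.underline_mem _⟩,
    fun _ => D.toVMod_underline _⟩

/-- **Uniqueness**: a map `𝕍(K) → V̲` compatible with restriction to `V_mod` is unique (`V̲ → V_mod` is injective, Def. 3.1 (e)
"a natural bijection `V̲ ⥲ V_mod`", L5-t2's `eq_of_toVMod_eq`). PROVED. [cite: Mochizuki2012, IUTchI Def. 3.1 (e) p. 62]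
[claim: Mochizuki2012, status: disputed] -/
theorem placeProjK_unique {π π' : Thm311.Real.Place K → D.V}
    (hπ : ∀ w : Thm311.Real.Place K, toVMod F K E ((π w : D.V) : Val K) =
      toVMod F K E (Sum.elim Val.arc (fun 𝔓 => Val.non (FinitePlace.mk 𝔓)) w))
    (hπ' : ∀ w : Thm311.Real.Place K, toVMod F K E ((π' w : D.V) : Val K) =
      toVMod F K E (Sum.elim Val.arc (fun 𝔓 => Val.non (FinitePlace.mk 𝔓)) w)) :
    π = π' :=
  funext fun w => Subtype.ext (D.eq_of_toVMod_eq (π w).2 (π' w).2 (by rw [hπ, hπ']))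

/-- Reading a valuation of `K` as a place of `K` and back is the identity (`FinitePlace.mk ∘ FinitePlace.maximalIdeal = id` on the finite
part; [IUTchI] §0 p. 35: `V(K) = V(K)^arc ∪ V(K)^non`). [folklore] -/
theorem val_of_place_of_val (u : Val K) :
    Sum.elim Val.arc (fun 𝔓 => Val.non (FinitePlace.mk 𝔓))
      (Sum.elim Sum.inl (fun x => Sum.inr (FinitePlace.maximalIdeal x)) u : Thm311.Real.Place K) = u := by
  rcases u with a | x
  · rfl
  · show Val.non (FinitePlace.mk (FinitePlace.maximalIdeal x)) = Sum.inr x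
    rw [FinitePlace.mk_maximalIdeal]
    rfl

/-- **The projection is a RETRACTION of the inclusion `V̲ ⊆ V(K) = 𝕍(K)`**: for `v̲ ∈ V̲`, read as a place of `K`
(`ι v̲ := v̲` — archimedean `Val.arc a ↦ a`, finite `Val.non x ↦` the prime `FinitePlace.maximalIdeal x`), `π (ι v̲) = v̲`
([IUTchI] Def. 3.1 (e): `V̲` "is a section of the natural surjection `V(K) ↠ V_mod`"; at the `K`-level the index set of the Dupuy–Hilado
setting literally CONTAINS `V̲`). PROVED. [cite: Mochizuki2012, IUTchI Def. 3.1 (e) p. 62] [claim: Mochizuki2012, status: disputed] -/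
theorem placeProjK_section {π : Thm311.Real.Place K → D.V}
    (hπ : ∀ w : Thm311.Real.Place K, toVMod F K E ((π w : D.V) : Val K) =
      toVMod F K E (Sum.elim Val.arc (fun 𝔓 => Val.non (FinitePlace.mk 𝔓)) w))
    (u : D.V) :
    π (Sum.elim Sum.inl (fun x => Sum.inr (FinitePlace.maximalIdeal x)) (u : Val K)) = u := by
  refine Subtype.ext (D.eq_of_toVMod_eq (π _).2 u.2 ?_)
  rw [hπ, val_of_place_of_val]

/-- **Surjectivity**: the natural projection `𝕍(K) → V̲` is ONTO (it has the section `ι`). PROVED.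
[cite: Mochizuki2012, IUTchI Def. 3.1 (e) p. 62] [claim: Mochizuki2012, status: disputed] -/
theorem placeProjK_surjective {π : Thm311.Real.Place K → D.V}
    (hπ : ∀ w : Thm311.Real.Place K, toVMod F K E ((π w : D.V) : Val K) =
      toVMod F K E (Sum.elim Val.arc (fun 𝔓 => Val.non (FinitePlace.mk 𝔓)) w)) :
    Function.Surjective π :=
  fun u => ⟨_, placeProjK_section D hπ u⟩

/-- **The inclusion `ι : V̲ → 𝕍(K)` is INJECTIVE** (it has the retraction `π`; directly: `V̲ ⊆ Val K` and `Val K → 𝕍(K)` is a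
bijection). So AT THE `K`-LEVEL the index set `V̲` of [IUTchI] Def. 3.1 (e) EMBEDS into the Dupuy–Hilado index set — in contrast with the
`F`-level (`Cor312ProvenancePlacesOver`: `not_injective_placeProj_of_two_above`). PROVED. [cite: Mochizuki2012, IUTchI Def. 3.1 (e) p. 62]
[claim: Mochizuki2012, status: disputed] -/
theorem placeInclK_injective :
    Function.Injective (fun u : D.V => (Sum.elim Sum.inl (fun x => Sum.inr (FinitePlace.maximalIdeal x)) (u : Val K) : Thm311.Real.Place K)) := by
  obtain ⟨π, hπ⟩ := exists_placeProjK D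
  exact (Function.LeftInverse.injective (g := π) fun u => placeProjK_section D hπ u)

/-- **Restriction in the tower `F_mod ⊆ F ⊆ K` at a prime of `K`**: the valuation of `F_mod` under the place `𝔓` of `K` is the one under
the place `𝔓 ∩ 𝓞_F` of `F` (L5-t2's `toVMod` IS the two-step restriction; `(𝔓 ∩ 𝓞_F)` = the tree's `finBelow F K 𝔓`, [IUTchIV] Def. 1.9
(ii)). [cite: Mochizuki2012, IUTchIV Def. 1.9 (ii) p. 22] -/
theorem toVMod_non_mk_eq_restrict_finBelow (𝔓 : HeightOneSpectrum (𝓞 K)) :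
    toVMod F K E (Val.non (FinitePlace.mk 𝔓)) =
      Val.restrict (fieldOfModuli E) (Val.non (FinitePlace.mk (finBelow F K 𝔓)) : Val F) := by
  show Val.restrict (fieldOfModuli E)
      (Val.non (FinitePlace.mk ((FinitePlace.maximalIdeal (FinitePlace.mk 𝔓)).under (𝓞 F))) : Val F) = _
  rw [FinitePlace.maximalIdeal_mk]
  rfl

/-- The valuation of `F_mod` under a place `w` of `K` is the one under the place `w|_F` of `F` below it ([IUTchIV] Def. 1.9 (ii)'s
`Place.below F K`; archimedean: `comap` in the tower, finite: `toVMod_non_mk_eq_restrict_finBelow`). [cite: Mochizuki2012, IUTchIV Def. 1.9 (ii) p. 22] -/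
theorem toVMod_place_eq_restrict_below (w : Thm311.Real.Place K) :
    toVMod F K E (Sum.elim Val.arc (fun 𝔓 => Val.non (FinitePlace.mk 𝔓)) w) =
      Val.restrict (fieldOfModuli E)
        (Sum.elim Val.arc (fun 𝔭 => Val.non (FinitePlace.mk 𝔭)) (Literature.IUT.LogVolume.Place.below F K w) : Val F) := by
  rcases w with a | 𝔓
  · rfl
  · exact toVMod_non_mk_eq_restrict_finBelow 𝔓

/-- **`π_K = π_F ∘ (·)|_F`**: the `K`-level projection factors through the `F`-level projection of `Cor312ProvenancePlacesOver`
(p433104) along the restriction of places `𝕍(K) → 𝕍(F)` ([IUTchIV] Def. 1.9 (ii) `Place.below F K`) — the two bookkeepings are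
compatible in the tower `F_mod ⊆ F ⊆ K`. PROVED. [cite: Mochizuki2012, IUTchI Def. 3.1 (e) p. 62; IUTchIV Def. 1.9 (ii) p. 22]
[claim: Mochizuki2012, status: disputed] -/
theorem placeProjK_eq_placeProj_below {π : Thm311.Real.Place K → D.V}
    (hπ : ∀ w : Thm311.Real.Place K, toVMod F K E ((π w : D.V) : Val K) =
      toVMod F K E (Sum.elim Val.arc (fun 𝔓 => Val.non (FinitePlace.mk 𝔓)) w))
    {πF : Thm311.Real.Place F → D.V}
    (hπF : ∀ v : Thm311.Real.Place F, toVMod F K E ((πF v : D.V) : Val K) =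
      Val.restrict (fieldOfModuli E) (Sum.elim Val.arc (fun 𝔭 => Val.non (FinitePlace.mk 𝔭)) v))
    (w : Thm311.Real.Place K) : π w = πF (Literature.IUT.LogVolume.Place.below F K w) :=
  Subtype.ext (D.eq_of_toVMod_eq (π w).2 (πF _).2 (by rw [hπ, hπF, toVMod_place_eq_restrict_below]))

/-! ## 2. Bad places: `𝕍(K)^bad = S` is the preimage of `V̲^bad`; `V̲^bad = V̲ ∩ 𝕍(K)^bad` -/

/-- **`w ∈ S ↔ π w ∈ V̲^bad`** under the provenance link `IsPilotDataOfK D K Y` (`S` = the primes of `K` over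
`𝕍(F)^bad = 𝕍^bad_mod ×_{𝕍_mod} 𝕍(F)`, i.e. over `𝕍^bad_mod` — [IUTchI] Def. 3.1 (b)'s `V(K)^bad`): a place of `K` is a bad Dupuy–Hilado
index iff the member of `V̲` below-and-up lies in `V̲^bad`. So the bad DH index set over `K` is EXACTLY `π⁻¹(V̲^bad)` — for every genuine
datum. PROVED. [cite: Mochizuki2012, IUTchI Def. 3.1 (b)(e) pp. 61–62] [cite: DupuyHilado2025, §3.3] [claim: Mochizuki2012, status: disputed] -/
theorem mem_Vbad_iff_placeProjK_mem (hY : IsPilotDataOfK D K Y) {π : Thm311.Real.Place K → D.V}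
    (hπ : ∀ w : Thm311.Real.Place K, toVMod F K E ((π w : D.V) : Val K) =
      toVMod F K E (Sum.elim Val.arc (fun 𝔓 => Val.non (FinitePlace.mk 𝔓)) w))
    (w : Thm311.Real.Place K) : w ∈ (thetaIndex Y).Vbad ↔ ((π w : D.V) : Val K) ∈ D.Vbad := by
  -- `π w ∈ V̲` always, so `π w ∈ V̲^bad` iff the valuation of `F_mod` below `w` lies in `V^bad_mod`
  have hR : ((π w : D.V) : Val K) ∈ D.Vbad ↔
      toVMod F K E (Sum.elim Val.arc (fun 𝔓 => Val.non (FinitePlace.mk 𝔓)) w) ∈ Val.non '' D.VbadMod := by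
    rw [← hπ]
    exact ⟨fun h => h.2, fun h => ⟨(π w).2, h⟩⟩
  rw [hR, mem_thetaIndex_Vbad_iff]
  rcases w with a | 𝔓
  · -- archimedean: neither side holds
    constructor
    · rintro ⟨s, -, hs⟩
      exact absurd hs Sum.inl_ne_inr
    · intro h
      exact absurd h (restrict_arc_not_mem_image_non (E := E) (a.comap (algebraMap F K)) D.VbadMod)
  · -- finite: `𝔓 ∈ S ↔ FinitePlace.mk (𝔓 ∩ 𝓞_F) ∈ 𝕍(F)^bad ↔ (𝔓 ∩ 𝓞_F)|_{F_mod} ∈ V^bad_mod ↔ 𝔓|_{F_mod} ∈ V^bad_mod`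
    rw [Sum.elim_inr, toVMod_non_mk_eq_restrict_finBelow]
    change _ ↔ FinitePlace.mk (finBelow F K 𝔓) ∈ D.VFbad
    rw [← hY.mem_S_iff]
    constructor
    · rintro ⟨s, hs, hs'⟩
      obtain rfl : 𝔓 = s := Sum.inr_injective hs'
      exact hs
    · intro h
      exact ⟨𝔓, h, rfl⟩

/-- **`π(S) = V̲^bad`** (`= (thetaIndexOfInitial D).Vbad`): the natural projection maps the bad DH index set over `K` ONTO `V̲^bad`
(surjective + preimage). PROVED. [cite: Mochizuki2012, IUTchI Def. 3.1 (b)(e) pp. 61–62] [claim: Mochizuki2012, status: disputed] -/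
theorem placeProjK_image_Vbad (hY : IsPilotDataOfK D K Y) {π : Thm311.Real.Place K → D.V}
    (hπ : ∀ w : Thm311.Real.Place K, toVMod F K E ((π w : D.V) : Val K) =
      toVMod F K E (Sum.elim Val.arc (fun 𝔓 => Val.non (FinitePlace.mk 𝔓)) w)) :
    π '' (thetaIndex Y).Vbad = (thetaIndexOfInitial D).Vbad := by
  ext u
  constructor
  · rintro ⟨w, hw, rfl⟩
    exact (mem_Vbad_iff_placeProjK_mem D hY hπ w).mp hw
  · intro hu
    obtain ⟨w, rfl⟩ := placeProjK_surjective D hπ u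
    exact ⟨w, (mem_Vbad_iff_placeProjK_mem D hY hπ w).mpr hu, rfl⟩

/-- **`v̲ ∈ V̲^bad ↔ ι v̲ ∈ S`** — [IUTchI] Def. 3.1 (e) "`V̲^bad := V̲ ∩ V(K)^bad`" VERBATIM at the level of abc-iut-c312-5's index
skeletons: a member of the `M`-level index set `(thetaIndexOfInitial D).V = ↥V̲` is bad iff, read as a place of `K`, it is a bad index of the
`K`-level Dupuy–Hilado skeleton `thetaIndex Y` (under `IsPilotDataOfK D K Y`). PROVED.
[cite: Mochizuki2012, IUTchI Def. 3.1 (b)(e) pp. 61–62] [claim: Mochizuki2012, status: disputed] -/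
theorem mem_thetaIndexOfInitial_Vbad_iff_placeInclK_mem (hY : IsPilotDataOfK D K Y) (u : D.V) :
    u ∈ (thetaIndexOfInitial D).Vbad ↔
      (Sum.elim Sum.inl (fun x => Sum.inr (FinitePlace.maximalIdeal x)) (u : Val K) : Thm311.Real.Place K) ∈ (thetaIndex Y).Vbad := by
  obtain ⟨π, hπ⟩ := exists_placeProjK D
  rw [mem_Vbad_iff_placeProjK_mem D hY hπ, placeProjK_section D hπ u]
  exact Iff.rfl

/-- **`ι⁻¹(S) = V̲^bad`**: the preimage of the bad DH index set over `K` under the inclusion `V̲ ↪ 𝕍(K)` is `V̲^bad`. PROVED.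
[cite: Mochizuki2012, IUTchI Def. 3.1 (b)(e) pp. 61–62] [claim: Mochizuki2012, status: disputed] -/
theorem placeInclK_preimage_Vbad (hY : IsPilotDataOfK D K Y) :
    (fun u : D.V => (Sum.elim Sum.inl (fun x => Sum.inr (FinitePlace.maximalIdeal x)) (u : Val K) : Thm311.Real.Place K)) ⁻¹'
        (thetaIndex Y).Vbad = (thetaIndexOfInitial D).Vbad := by
  ext u
  exact (mem_thetaIndexOfInitial_Vbad_iff_placeInclK_mem D hY u).symm

/-! ## 3. Fibres of the projection -/

/-- **Fibres of the natural projection at finite places**: two primes of `𝓞 K` have the same image in `V̲` iff they lie over the same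
place of `F_mod` (through `F`: L5-t2's `InitialThetaData.finBelow` of the tree's `finBelow F K`). PROVED.
[cite: Mochizuki2012, IUTchI Def. 3.1 (e) p. 62; IUTchIV Def. 1.9 (ii) p. 22] [claim: Mochizuki2012, status: disputed] -/
theorem placeProjK_inr_eq_iff {π : Thm311.Real.Place K → D.V}
    (hπ : ∀ w : Thm311.Real.Place K, toVMod F K E ((π w : D.V) : Val K) =
      toVMod F K E (Sum.elim Val.arc (fun 𝔓 => Val.non (FinitePlace.mk 𝔓)) w))
    (𝔓₁ 𝔓₂ : HeightOneSpectrum (𝓞 K)) :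
    π (Sum.inr 𝔓₁) = π (Sum.inr 𝔓₂) ↔
      InitialThetaData.finBelow (E := E) (FinitePlace.mk (finBelow F K 𝔓₁)) =
        InitialThetaData.finBelow (E := E) (FinitePlace.mk (finBelow F K 𝔓₂)) := by
  have h₁ : toVMod F K E ((π (Sum.inr 𝔓₁) : D.V) : Val K) =
      Val.non (InitialThetaData.finBelow (E := E) (FinitePlace.mk (finBelow F K 𝔓₁))) := by
    rw [hπ, Sum.elim_inr, toVMod_non_mk_eq_restrict_finBelow]; rfl
  have h₂ : toVMod F K E ((π (Sum.inr 𝔓₂) : D.V) : Val K) =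
      Val.non (InitialThetaData.finBelow (E := E) (FinitePlace.mk (finBelow F K 𝔓₂))) := by
    rw [hπ, Sum.elim_inr, toVMod_non_mk_eq_restrict_finBelow]; rfl
  constructor
  · intro h
    have h' : toVMod F K E ((π (Sum.inr 𝔓₁) : D.V) : Val K) = toVMod F K E ((π (Sum.inr 𝔓₂) : D.V) : Val K) := by
      rw [h]
    rw [h₁, h₂] at h'
    exact Sum.inr_injective h'
  · intro h
    refine Subtype.ext (D.eq_of_toVMod_eq (π _).2 (π _).2 ?_)
    rw [h₁, h₂, h]

/-- **The projection is a bijection only when no place splits**: if two distinct primes of `𝓞 K` lie over the same place of `F_mod`,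
`π : 𝕍(K) → V̲` is not injective (so `V̲ ⊊ 𝕍(K)` strictly as soon as `[K : F_mod] > 1` has a split place; the section `ι` picks ONE
place over each valuation of `F_mod` — Def. 3.1 (e)). PROVED. [cite: Mochizuki2012, IUTchI Def. 3.1 (e) p. 62] [claim: Mochizuki2012, status: disputed] -/
theorem not_injective_placeProjK_of_two_above {π : Thm311.Real.Place K → D.V}
    (hπ : ∀ w : Thm311.Real.Place K, toVMod F K E ((π w : D.V) : Val K) =
      toVMod F K E (Sum.elim Val.arc (fun 𝔓 => Val.non (FinitePlace.mk 𝔓)) w))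
    {𝔓₁ 𝔓₂ : HeightOneSpectrum (𝓞 K)} (hne : 𝔓₁ ≠ 𝔓₂)
    (hbelow : InitialThetaData.finBelow (E := E) (FinitePlace.mk (finBelow F K 𝔓₁)) =
      InitialThetaData.finBelow (E := E) (FinitePlace.mk (finBelow F K 𝔓₂))) :
    ¬ Function.Injective π := fun hinj =>
  hne (Sum.inr_injective (hinj ((placeProjK_inr_eq_iff D hπ 𝔓₁ 𝔓₂).mpr hbelow)))

/-! ## 4. Headlines: the `M`-level index skeleton re-indexes INTO the `K`-level Dupuy–Hilado one -/

/-- **Re-indexing over abc-iut-c312-5's `thetaIndexOfInitial`, AT THE `K`-LEVEL**: under `IsPilotDataOfK D K Y` there is an INJECTION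
`ι : (thetaIndexOfInitial D).V = ↥V̲ ↪ (thetaIndex Y).V = 𝕍(K)` with `v ∈ (thetaIndexOfInitial D).Vbad ↔ ι v ∈ (thetaIndex Y).Vbad` —
[IUTchI] Def. 3.1 (e) "`V̲ ⊆ V(K)` … `V̲^bad := V̲ ∩ V(K)^bad`" as a statement about the two typed index skeletons; the honest form, at the
level print works at, of the READ binder `hplaces : ∃ e : (thetaIndex X).V ≃ D.V, ∀ v, v ∈ (thetaIndex X).Vbad ↔ ↑(e v) ∈ D.Vbad` of
`Conditional/AbcOfSGenuine.lean` v3/v4 (deleted as idle, p432598; `≃` replaced by the injection `ι` with retraction `π`). PROVED; no side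
condition. [cite: Mochizuki2012, IUTchI Def. 3.1 (b)(e) pp. 61–62, Ex. 3.2 (iv) p. 71] [cite: DupuyHilado2025, §3.3] [claim: Mochizuki2012, status: disputed] -/
theorem exists_placeIncl_injective_mem_Vbad_iff (hY : IsPilotDataOfK D K Y) :
    ∃ ι : (thetaIndexOfInitial D).V → (thetaIndex Y).V, Function.Injective ι ∧
      ∀ v : (thetaIndexOfInitial D).V, v ∈ (thetaIndexOfInitial D).Vbad ↔ ι v ∈ (thetaIndex Y).Vbad :=
  ⟨fun u : D.V => (Sum.elim Sum.inl (fun x => Sum.inr (FinitePlace.maximalIdeal x)) (u : Val K) : Thm311.Real.Place K),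
    placeInclK_injective D, mem_thetaIndexOfInitial_Vbad_iff_placeInclK_mem D hY⟩

/-- **The natural projection WITH its section, for EVERY genuine datum**: under `IsPilotDataOfK D K Y` there are
`π : (thetaIndex Y).V = 𝕍(K) → ↥V̲` and `ι : ↥V̲ → 𝕍(K)` with `π` surjective, `π (ι v̲) = v̲`, and `w ∈ (thetaIndex Y).Vbad ↔ ↑(π w) ∈ V̲^bad`
([IUTchI] Def. 3.1 (e) "a section of the natural surjection `V(K) ↠ V_mod`" + (b)): the `K`-level twin of
`exists_placeProj_surjective_mem_Vbad_iff` (p433104) with the SECTION that the `F`-level lacks. PROVED; no side condition.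
[cite: Mochizuki2012, IUTchI Def. 3.1 (b)(e) pp. 61–62] [cite: DupuyHilado2025, §3.3] [claim: Mochizuki2012, status: disputed] -/
theorem exists_placeProjK_surjective_section_mem_Vbad_iff (hY : IsPilotDataOfK D K Y) :
    ∃ (π : (thetaIndex Y).V → D.V) (ι : D.V → (thetaIndex Y).V), Function.Surjective π ∧ (∀ u : D.V, π (ι u) = u) ∧
      ∀ w : (thetaIndex Y).V, w ∈ (thetaIndex Y).Vbad ↔ ((π w : D.V) : Val K) ∈ D.Vbad := by
  obtain ⟨π, hπ⟩ := exists_placeProjK D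
  exact ⟨π, fun u : D.V => (Sum.elim Sum.inl (fun x => Sum.inr (FinitePlace.maximalIdeal x)) (u : Val K) : Thm311.Real.Place K),
    placeProjK_surjective D hπ, placeProjK_section D hπ, mem_Vbad_iff_placeProjK_mem D hY hπ⟩

/-- **INSTANTIATED at v5's own datum** — the `K`-level pilot datum `pilotDataOfK D K` OF `D` (abc-iut-C-cert-3's `Cor312ProvK`,
`isPilotDataOfK_pilotDataOfK`): the `M`-level index skeleton `thetaIndexOfInitial D` re-indexes injectively into
`thetaIndex (pilotDataOfK D K)` respecting bad places. NON-VACUITY of the headline by name; no hypothesis beyond `D`. PROVED.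
[cite: Mochizuki2012, IUTchI Def. 3.1 (b)(e) pp. 61–62] [claim: Mochizuki2012, status: disputed] -/
theorem exists_placeIncl_injective_mem_Vbad_iff_pilotDataOfK :
    ∃ ι : (thetaIndexOfInitial D).V → (thetaIndex (pilotDataOfK D K)).V, Function.Injective ι ∧
      ∀ v : (thetaIndexOfInitial D).V,
        v ∈ (thetaIndexOfInitial D).Vbad ↔ ι v ∈ (thetaIndex (pilotDataOfK D K)).Vbad :=
  exists_placeIncl_injective_mem_Vbad_iff D (isPilotDataOfK_pilotDataOfK D K)

/-- **INSTANTIATED at v5's own datum** — the surjection-with-section form at `pilotDataOfK D K`: the provenance sentence available to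
the branch-C certificate v5 for EVERY genuine datum («the DH index set `𝕍(K)` of the setting CONTAINS `V̲` as a retract, with `𝕍(K)^bad`
the preimage of `V̲^bad`»). PROVED; no hypothesis beyond `D`. [cite: Mochizuki2012, IUTchI Def. 3.1 (b)(e) pp. 61–62] [claim: Mochizuki2012, status: disputed] -/
theorem exists_placeProjK_surjective_section_mem_Vbad_iff_pilotDataOfK :
    ∃ (π : (thetaIndex (pilotDataOfK D K)).V → D.V) (ι : D.V → (thetaIndex (pilotDataOfK D K)).V),
      Function.Surjective π ∧ (∀ u : D.V, π (ι u) = u) ∧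
      ∀ w : (thetaIndex (pilotDataOfK D K)).V,
        w ∈ (thetaIndex (pilotDataOfK D K)).Vbad ↔ ((π w : D.V) : Val K) ∈ D.Vbad :=
  exists_placeProjK_surjective_section_mem_Vbad_iff D (isPilotDataOfK_pilotDataOfK D K)

end Summit.ABC.IUTFork.Cor312Prov

end
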